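import Summits.CriticalPhenomena.PercolationContinuityZ3.Theorems.PercNearOneGluingNoHeavyLowerTailSahiWidthPhaseDiagram

/-!
# `NoHeavyLowerTail` (crux stmt-CriticalPhenomena-4575), Sahi programme P1: SAHI POSITIVITY OF ORDER 3 DOES NOT TENSORISE —
# the 27-point hypothesis (TL27) of `…SahiTensorLift` is FALSE

Support file (Sahi cell, seat `prim-sahi-p1`, generation 5; `--supports stmt-CriticalPhenomena-4575`).  Standard axioms plus
`Lean.ofReduceBool` for ONE `native_decide` evaluation (flagged COMPUTATIONAL): the table of `61³` integer cubic forms over the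
up-sets of the 14-point support (`S14.allTriplesOK_upL`); everything else is kernel-checked (`decide`).  The same certificate was
checked by an independent C program in exact integer arithmetic over all `157 345 860` up-set triples of `[3]³`
(prim-sahi-p1/certs/TL27-exact_check.c, masses in prim-sahi-p1/certs/m1000.txt).

`…SahiTensorLift` reduced Sahi's `C_3` to the hypothesis

  (TL27)  every order-3 Sahi-positive probability weight `m` on `[3]³` has `E_3 ≥ 0` for the three coordinate two-layer indicators
          under the fair-coin lift `(t,y) ↦ m(y)/2`.

THIS FILE REFUTES (TL27) (`not_coord27`), so `sahiConjecture_three_of_coord27` / `kahnConjecture_of_coord27` are VACUOUS (true, but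
with a false hypothesis).  The witness is the `S_3`-symmetric weight with masses (in thousandths)
`138` at `(0,0,0)`; `88` at `(1,0,0),(0,1,0),(0,0,1)`; `7` at `(0,1,1),(1,0,1),(1,1,0)`; `132` at `(2,2,0),(2,0,2),(0,2,2)`;
`10` at `(2,2,1),(2,1,2),(1,2,2)`; `151` at `(2,2,2)`; `0` elsewhere (`n27`).  It is Sahi-positive of order 3 — on its 14-point support
`S` the up-sets have 61 traces and all `61³` values of `10⁹·E_3` are nonnegative integers (`e3Z_nonneg_table`), and a weight supported
on `S` is the monotone image of its restriction (`sahiPositive_m27`) — but the lifted coordinate triple has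
`8·10⁹·E_3 = −8 829 832 < 0` (`lift_coord_neg`).  Consequently (`exists_sahiPositive_three_not_tensor`): THERE IS A FINITE
DISTRIBUTIVE LATTICE WITH AN ORDER-3 SAHI-POSITIVE PROBABILITY WEIGHT WHOSE PRODUCT WITH A FAIR COIN IS NOT ORDER-3 SAHI-POSITIVE —
positive association (`n = 2`) tensorises, `E_3`-positivity does not.  (The weight is not FKG: `m(000)m(101) = 0 < m(001)m(100)`;
Sahi's conjecture concerns FKG weights and is untouched.  Mechanism: the inner sections `{y_i = 2}` form a triple of type
`(U∪V, V∪W, W∪U)` with `E_3 ≈ 0` — an equality case that product/FKG weights do not attain — while the points with two coordinates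
equal to `1` carry the negative band term of the identity of PROOF-C3 §17(d).)  New mathematics; the certificate is this programme's.
-/

namespace Summit.CriticalPhenomena.PercolationContinuityZ3.Theorems.SahiLayer

open Finset Function Literature.Combinatorics.Sahi2008 Literature.Probability.LatticeModels
open scoped BigOperators

/-! ## `E_3` of three indicators under a weight with natural-number masses -/

section IntegerForm

variable {α : Type*} [Fintype α] [DecidableEq α]

/-- `E_3(1_A,1_B,1_C)` in terms of masses of intersections. [cite: LiebSahi2021, eq. (2.1)] -/
theorem sahiE_three_setInd_eq_mass (μ : α → ℝ) (U : Fin 3 → Finset α) :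
    sahiE μ 3 (fun i => setInd (U i)) =
      2 * mass μ (U 0 ∩ U 1 ∩ U 2) + mass μ (U 0) * mass μ (U 1) * mass μ (U 2) -
        (mass μ (U 0) * mass μ (U 1 ∩ U 2) + mass μ (U 1) * mass μ (U 0 ∩ U 2) + mass μ (U 2) * mass μ (U 0 ∩ U 1)) := by
  rw [sahiE_three_apply]
  simp only [setInd_mul, ex_setInd]

/-- The integer numerator of `E³·E_3(1_A,1_B,1_C)` for the weight `x ↦ c(x)/E`. [this work] -/
def e3Z (c : α → ℕ) (E : ℕ) (A B C : Finset α) : ℤ :=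
  2 * ((∑ x ∈ A ∩ B ∩ C, c x : ℕ) : ℤ) * E ^ 2 +
      ((∑ x ∈ A, c x : ℕ) : ℤ) * ((∑ x ∈ B, c x : ℕ) : ℤ) * ((∑ x ∈ C, c x : ℕ) : ℤ) -
    (((∑ x ∈ A, c x : ℕ) : ℤ) * ((∑ x ∈ B ∩ C, c x : ℕ) : ℤ) + ((∑ x ∈ B, c x : ℕ) : ℤ) * ((∑ x ∈ A ∩ C, c x : ℕ) : ℤ) +
        ((∑ x ∈ C, c x : ℕ) : ℤ) * ((∑ x ∈ A ∩ B, c x : ℕ) : ℤ)) * E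

omit [Fintype α] [DecidableEq α] in
/-- Masses of the weight `c/E` are `(Σ c)/E`. [this work] -/
theorem mass_natDiv (c : α → ℕ) (E : ℕ) (A : Finset α) :
    mass (fun x => (c x : ℝ) / E) A = ((∑ x ∈ A, c x : ℕ) : ℝ) / E := by
  unfold mass
  rw [Nat.cast_sum, Finset.sum_div]

/-- `E³ · E_3(1_A,1_B,1_C) = e3Z` for the weight `c/E`. [this work] -/
theorem sahiE_three_setInd_natDiv (c : α → ℕ) {E : ℕ} (hE : E ≠ 0) (U : Fin 3 → Finset α) :
    (E : ℝ) ^ 3 * sahiE (fun x => (c x : ℝ) / E) 3 (fun i => setInd (U i)) = (e3Z c E (U 0) (U 1) (U 2) : ℝ) := by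
  rw [sahiE_three_setInd_eq_mass]
  simp only [mass_natDiv, e3Z]
  have hE' : (E : ℝ) ≠ 0 := by exact_mod_cast hE
  push_cast
  field_simp

/-- Hence `E_3(1_A,1_B,1_C) ≥ 0` as soon as `e3Z ≥ 0`, and `< 0` as soon as `e3Z < 0`. [this work] -/
theorem sahiE_three_setInd_nonneg_of_e3Z (c : α → ℕ) {E : ℕ} (hE : E ≠ 0) (U : Fin 3 → Finset α)
    (h : 0 ≤ e3Z c E (U 0) (U 1) (U 2)) : 0 ≤ sahiE (fun x => (c x : ℝ) / E) 3 (fun i => setInd (U i)) := by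
  have h1 := sahiE_three_setInd_natDiv c hE U
  have hE3 : (0 : ℝ) < (E : ℝ) ^ 3 := by positivity
  have h2 : (0 : ℝ) ≤ (e3Z c E (U 0) (U 1) (U 2) : ℝ) := by exact_mod_cast h
  nlinarith

/-- `E_3(1_A,1_B,1_C) < 0` as soon as `e3Z < 0`. [this work] -/
theorem sahiE_three_setInd_neg_of_e3Z (c : α → ℕ) {E : ℕ} (hE : E ≠ 0) (U : Fin 3 → Finset α)
    (h : e3Z c E (U 0) (U 1) (U 2) < 0) : sahiE (fun x => (c x : ℝ) / E) 3 (fun i => setInd (U i)) < 0 := by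
  have h1 := sahiE_three_setInd_natDiv c hE U
  have hE3 : (0 : ℝ) < (E : ℝ) ^ 3 := by positivity
  have h2 : (e3Z c E (U 0) (U 1) (U 2) : ℝ) < 0 := by exact_mod_cast h
  nlinarith

end IntegerForm

/-! ## The witness -/

/-- Masses (in thousandths) of the witness weight on `[3]³`, by coordinates (pattern match on the three values; `0` off the
14-point support). [this work] -/
def n27N : ℕ → ℕ → ℕ → ℕ
  | 0, 0, 0 => 138
  | 1, 0, 0 => 88 | 0, 1, 0 => 88 | 0, 0, 1 => 88
  | 0, 1, 1 => 7 | 1, 0, 1 => 7 | 1, 1, 0 => 7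
  | 2, 2, 0 => 132 | 2, 0, 2 => 132 | 0, 2, 2 => 132
  | 2, 2, 1 => 10 | 2, 1, 2 => 10 | 1, 2, 2 => 10
  | 2, 2, 2 => 151
  | _, _, _ => 0

/-- Masses (in thousandths) of the witness weight on `[3]³ = (Fin 3 → Fin 3)`. [this work] -/
def n27 (y : Fin 3 → Fin 3) : ℕ := n27N (y 0).val (y 1).val (y 2).val

/-- The 14 support points (index type; the order is pulled back from `[3]³`). [this work] -/
structure S14 where
  /-- index of the support point -/
  idx : Fin 14
  deriving DecidableEq, Fintype

namespace S14

/-- Coordinates of the support points, by index and coordinate (pattern match). [this work] -/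
def embN : ℕ → ℕ → Fin 3
  | 0, _ => 0
  | 1, 0 => 1 | 1, _ => 0
  | 2, 1 => 1 | 2, _ => 0
  | 3, 2 => 1 | 3, _ => 0
  | 4, 0 => 0 | 4, _ => 1
  | 5, 1 => 0 | 5, _ => 1
  | 6, 2 => 0 | 6, _ => 1
  | 7, 2 => 0 | 7, _ => 2
  | 8, 1 => 0 | 8, _ => 2
  | 9, 0 => 0 | 9, _ => 2
  | 10, 2 => 1 | 10, _ => 2
  | 11, 1 => 1 | 11, _ => 2
  | 12, 0 => 1 | 12, _ => 2
  | 13, _ => 2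
  | _, _ => 0

/-- Coordinates of the support points: `000; 100,010,001; 011,101,110; 220,202,022; 221,212,122; 222`. [this work] -/
def emb (s : S14) : Fin 3 → Fin 3 := fun i => embN s.idx.val i.val

/-- Masses of the support points (thousandths), by index. [this work] -/
def nvN : ℕ → ℕ
  | 0 => 138 | 1 => 88 | 2 => 88 | 3 => 88 | 4 => 7 | 5 => 7 | 6 => 7
  | 7 => 132 | 8 => 132 | 9 => 132 | 10 => 10 | 11 => 10 | 12 => 10 | 13 => 151 | _ => 0

/-- Masses of the support points (thousandths). [this work] -/
def nv (s : S14) : ℕ := nvN s.idx.val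

/-- The order of the support points: pulled back from `[3]³` along `emb`. [this work] -/
instance : Preorder S14 := Preorder.lift emb

/-- `emb` is monotone (by construction of the order). [this work] -/
theorem emb_mono : Monotone emb := fun _ _ h => h

/-- Total mass `1000`. COMPUTATIONAL (`decide`). [this work] -/
theorem sum_nv : ∑ s : S14, nv s = 1000 := by decide

/-- The fibres of `emb` carry the masses `n27` (kernel `decide`). [this work] -/
theorem sum_fibre_nv : ∀ y : Fin 3 → Fin 3, (∑ s ∈ univ.filter (fun s : S14 => emb s = y), nv s) = n27 y := by
  decide

/-- Boolean up-set test on the support poset. [this work] -/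
def isUpB (A : Finset S14) : Bool :=
  decide (∀ a ∈ A, ∀ b : S14, (∀ i, emb a i ≤ emb b i) → b ∈ A)

/-- An up-set of the support poset passes the test. [this work] -/
theorem isUpB_of_isUpperSet {A : Finset S14} (hA : IsUpperSet (A : Set S14)) : isUpB A = true := by
  unfold isUpB
  rw [decide_eq_true_eq]
  intro a ha b hab
  have hle : a ≤ b := fun i => hab i
  exact hA hle ha

/-- The 14 points, as a list. [this work] -/
def elems : List S14 := (List.finRange 14).map S14.mk

/-- Every point is listed. [this work] -/
theorem mem_elems (s : S14) : s ∈ elems := by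
  obtain ⟨i⟩ := s
  exact List.mem_map.2 ⟨i, List.mem_finRange i, rfl⟩

/-- The up-sets of the support poset, as a LIST (sublists of `elems` passing `isUpB`; 61 of them). [this work] -/
def upL : List (Finset S14) := ((elems.sublists).map List.toFinset).filter fun A => isUpB A

/-- Completeness of the list: every up-set of the support poset is in `upL`. [this work] -/
theorem mem_upL {A : Finset S14} (hA : IsUpperSet (A : Set S14)) : A ∈ upL := by
  classical
  unfold upL
  rw [List.mem_filter]
  refine ⟨List.mem_map.2 ⟨elems.filter (fun s => decide (s ∈ A)), List.mem_sublists.2 List.filter_sublist, ?_⟩,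
    isUpB_of_isUpperSet hA⟩
  ext s
  simp only [List.mem_toFinset, List.mem_filter, decide_eq_true_eq, mem_elems s, true_and]

/-- The certificate check: all `|upL|³` integer cubic forms are nonnegative (the list is passed ONCE as an argument). [this work] -/
def allTriplesOK (L : List (Finset S14)) : Bool :=
  L.all fun A => L.all fun B => L.all fun C => decide (0 ≤ e3Z nv 1000 A B C)

/-- **The certificate** (`61³` integer cubic forms).  COMPUTATIONAL (`native_decide`). [this work] -/
theorem allTriplesOK_upL : allTriplesOK upL = true := by
  native_decide

/-- The certificate, unpacked. [this work] -/
theorem e3Z_nonneg_table {A B C : Finset S14} (hA : A ∈ upL) (hB : B ∈ upL) (hC : C ∈ upL) :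
    0 ≤ e3Z nv 1000 A B C := by
  have h := allTriplesOK_upL
  unfold allTriplesOK at h
  rw [List.all_eq_true] at h
  have h2 := h A hA
  rw [List.all_eq_true] at h2
  have h3 := h2 B hB
  rw [List.all_eq_true] at h3
  exact of_decide_eq_true (h3 C hC)

/-- **The witness is Sahi-positive of order 3 on its support poset.** [this work] -/
theorem sahiPositive_S14 : SahiPositive (fun s : S14 => (nv s : ℝ) / (1000 : ℕ)) 3 := by
  classical
  rw [sahiPositive_iff_indicators]
  intro U hU
  exact sahiE_three_setInd_nonneg_of_e3Z _ (by norm_num) U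
    (e3Z_nonneg_table (mem_upL (hU 0)) (mem_upL (hU 1)) (mem_upL (hU 2)))

/-- The witness weight on `[3]³` is the push-forward of its restriction along `emb`: explicitly `y ↦ n27(y)/1000`. [this work] -/
theorem pushWeight_nv_emb :
    pushWeight (fun s : S14 => (nv s : ℝ) / (1000 : ℕ)) emb = fun y => (n27 y : ℝ) / (1000 : ℕ) := by
  classical
  funext y
  rw [pushWeight_apply, ← sum_fibre_nv y, Nat.cast_sum, Finset.sum_div, Finset.sum_filter]

end S14

open S14

/-- **The witness is an order-3 Sahi-positive probability weight on `[3]³`.** [this work] -/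
theorem sahiPositive_m27 : SahiPositive (fun y : Fin 3 → Fin 3 => (n27 y : ℝ) / (1000 : ℕ)) 3 := by
  rw [← pushWeight_nv_emb]
  exact sahiPositive_S14.of_pushWeight emb_mono

/-- The witness weight is nonnegative. [this work] -/
theorem m27_nonneg (y : Fin 3 → Fin 3) : 0 ≤ (n27 y : ℝ) / (1000 : ℕ) := by positivity

/-- The witness weight has total mass one. [this work] -/
theorem sum_m27 : ∑ y : Fin 3 → Fin 3, (n27 y : ℝ) / (1000 : ℕ) = 1 := by
  rw [← pushWeight_nv_emb, sum_pushWeight, ← Finset.sum_div, ← Nat.cast_sum, sum_nv]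
  norm_num

/-! ## The lifted coordinate triple is negative -/

/-- The three coordinate two-layer indicator sets on `Bool × [3]³`. [this work] -/
def coordSet (i : Fin 3) : Finset (Bool × (Fin 3 → Fin 3)) :=
  univ.filter fun x => if x.1 = true then (1 : Fin 3) ≤ x.2 i else x.2 i = 2

/-- The coordinate two-layer indicator functions are the indicators of `coordSet`. [this work] -/
theorem coordFun_eq_setInd :
    (fun (i : Fin 3) (x : Bool × (Fin 3 → Fin 3)) =>
        if x.1 = true then (if (1 : Fin 3) ≤ x.2 i then (1 : ℝ) else 0) else (if x.2 i = 2 then (1 : ℝ) else 0)) =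
      fun i => setInd (coordSet i) := by
  funext i x
  simp only [setInd_apply, coordSet, Finset.mem_filter, Finset.mem_univ, true_and]
  by_cases h : x.1 = true <;> simp [h]

/-- **The certificate, lifted side**: `8·10⁹·E_3` of the coordinate triple under the fair-coin lift is `−8 829 832 < 0`.
(kernel `decide`). [this work] -/
theorem e3Z_lift_neg :
    e3Z (fun x : Bool × (Fin 3 → Fin 3) => n27 x.2) 2000 (coordSet 0) (coordSet 1) (coordSet 2) < 0 := by
  decide

/-- The fair-coin lift of the witness is the weight `x ↦ n27(x.2)/2000`. [this work] -/
theorem lift_m27_eq :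
    (fun x : Bool × (Fin 3 → Fin 3) => (1 / 2 : ℝ) * ((n27 x.2 : ℝ) / (1000 : ℕ))) =
      fun x => ((fun x : Bool × (Fin 3 → Fin 3) => n27 x.2) x : ℝ) / (2000 : ℕ) := by
  funext x
  push_cast
  ring

/-- **The lifted coordinate triple has `E_3 < 0`.** [this work] -/
theorem lift_coord_neg :
    sahiE (fun x : Bool × (Fin 3 → Fin 3) => (1 / 2 : ℝ) * ((n27 x.2 : ℝ) / (1000 : ℕ))) 3
        (fun i x => if x.1 = true then (if (1 : Fin 3) ≤ x.2 i then (1 : ℝ) else 0)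
          else (if x.2 i = 2 then (1 : ℝ) else 0)) < 0 := by
  rw [coordFun_eq_setInd, lift_m27_eq]
  exact sahiE_three_setInd_neg_of_e3Z (fun x : Bool × (Fin 3 → Fin 3) => n27 x.2) (by norm_num)
    (fun i => coordSet i) e3Z_lift_neg

/-! ## Conclusions -/

/-- **(TL27) IS FALSE**: the 27-point hypothesis of `sahiConjecture_three_of_coord27` fails (so that theorem, though correct, is vacuous).
[this work] -/
theorem not_coord27 :
    ¬ (∀ m : (Fin 3 → Fin 3) → ℝ, (∀ y, 0 ≤ m y) → ∑ y, m y = 1 → SahiPositive m 3 →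
      0 ≤ sahiE (fun x : Bool × (Fin 3 → Fin 3) => (1 / 2 : ℝ) * m x.2) 3
        (fun i x => if x.1 = true then (if (1 : Fin 3) ≤ x.2 i then (1 : ℝ) else 0)
          else (if x.2 i = 2 then (1 : ℝ) else 0))) := fun H =>
  absurd (H _ m27_nonneg sum_m27 sahiPositive_m27) (not_le.2 lift_coord_neg)

/-- The coordinate two-layer sets are up-sets of `Bool × [3]³`. [this work] -/
theorem isUpperSet_coordSet (i : Fin 3) : IsUpperSet (coordSet i : Set (Bool × (Fin 3 → Fin 3))) := by
  intro x y hxy hx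
  rw [mem_coe, coordSet, mem_filter] at hx ⊢
  refine ⟨mem_univ _, ?_⟩
  have h1 : x.1 ≤ y.1 := hxy.1
  have h2 : x.2 i ≤ y.2 i := hxy.2 i
  have h2' : (x.2 i : ℕ) ≤ (y.2 i : ℕ) := h2
  have hy3 : (y.2 i : ℕ) < 3 := (y.2 i).isLt
  obtain ⟨_, hx⟩ := hx
  by_cases hy : y.1 = true
  · rw [if_pos hy]
    show ((1 : Fin 3) : ℕ) ≤ (y.2 i : ℕ)
    by_cases hx1 : x.1 = true
    · rw [if_pos hx1] at hx
      have : ((1 : Fin 3) : ℕ) ≤ (x.2 i : ℕ) := hx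
      omega
    · rw [if_neg hx1] at hx
      have : (x.2 i : ℕ) = 2 := by rw [hx]; rfl
      simp only [Fin.val_one] at *
      omega
  · rw [if_neg hy]
    have hx1 : ¬ x.1 = true := by
      intro hx1
      rw [hx1] at h1
      exact hy (by revert h1; cases y.1 <;> simp)
    rw [if_neg hx1] at hx
    have : (x.2 i : ℕ) = 2 := by rw [hx]; rfl
    apply Fin.ext
    show (y.2 i : ℕ) = ((2 : Fin 3) : ℕ)
    simp only [Fin.val_two] at *
    omega

/-- **SAHI POSITIVITY OF ORDER 3 DOES NOT TENSORISE**: there is an order-3 Sahi-positive probability weight on the finite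
distributive lattice `[3]³` whose product with the fair coin on `Bool` — a probability weight on the distributive lattice
`Bool × [3]³` — is not order-3 Sahi-positive. [this work] -/
theorem exists_sahiPositive_three_not_tensor :
    ∃ m : (Fin 3 → Fin 3) → ℝ, (∀ y, 0 ≤ m y) ∧ ∑ y, m y = 1 ∧ SahiPositive m 3 ∧
      ¬ SahiPositive (fun x : Bool × (Fin 3 → Fin 3) => (1 / 2 : ℝ) * m x.2) 3 := by
  refine ⟨_, m27_nonneg, sum_m27, sahiPositive_m27, fun h => ?_⟩
  have key := h (fun i => setInd (coordSet i)) (fun i x => setInd_nonneg _ _)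
    (fun i => monotone_setInd (isUpperSet_coordSet i))
  rw [← coordFun_eq_setInd] at key
  exact absurd key (not_le.2 lift_coord_neg)

end Summit.CriticalPhenomena.PercolationContinuityZ3.Theorems.SahiLayer
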